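import Mathlib
import Summits.PneNP.PneNP.Theses.OneSlice
import Summits.PneNP.PneNP.Theorems.OneSliceSliceTargetSplit
import Summits.PneNP.PneNP.Theorems.OneSliceMonotoneContinuationFragileJump

/-!
# Route OneSlice, crux `MonotoneContinuation` (stmt-PneNP-18471), line `Sketch_ideator1_r1` (ProfileLine) — stub `profileDrop_of_cofragile`

`profileDrop_of_cofragile`: the downward mirror of the width-1 obstruction `profileJump_of_fragile`. A purely
combinatorial lower bound on the profile DROP from slice `j-1` to slice `j` of ANY monotone function that is
`η`-faithful on slice `j` to a slice set `h`, in terms of two features of `h` one level DOWN: the cofragile part `Z`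
(points of weight `j-1` with at least one rejected up-neighbour) and the corobust part `R = R_b` (points with at most
`b` accepted up-neighbours), and the maximal cofragile down-degree `φ` of a point of slice `j`.

Proof (pure counting, accept ↔ reject and subset ↔ superset in the proof of `profileJump_of_fragile`). Let
`E₀ = {x ∈ slice j : h x = 0, f x = 1}`; faithfulness gives `#E₀ ≤ η·#slice_j`.
* A point `z ∈ Z` accepted by `f` has, by monotonicity, all its up-neighbours accepted, in particular its rejected
  `h`-neighbour lies in `E₀`; charging `z` to it, every `x ∈ E₀` is charged at most `φ` times, so
  `#{z ∈ Z : f z = 1} ≤ φ·#E₀` (`profileDrop_cardZ`).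
* A point `z ∈ R` accepted by `f` has `≥ N-(j-1)-b` up-neighbours in `E₀` (`N = C(n,2)`); double counting the
  comparable pairs between `E₀` and slice `j-1` (each `x ∈ slice j` has exactly `j` down-neighbours) gives
  `#{z ∈ R : f z = 1}·(N-(j-1)-b) ≤ j·#E₀` (`profileDrop_cardR`), and `j·C(N,j) = (N-(j-1))·C(N,j-1)` with
  `2b ≤ N-(j-1)` turns this into `≤ 2η·#slice_{j-1}`.
* `#{f = 0 on slice j} ≤ #{h = 0 on slice j} + η·#slice_j` bounds the rescaled level-`j` term.
The three estimates are combined by linear arithmetic (`profileDrop_arith`); the hypothesis `j ≤ C(n,2)` (slice `j`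
nonempty) is necessary: for `j = C(n,2)+1`, `f ≡ 1`, `Z = ∅`, `R = slice (j-1)`, `b = φ = 0`, `η = 0` the
inequality reads `1 ≤ 0`.
-/

set_option linter.dupNamespace false -- `Summit.PneNP.PneNP.…`: summit = sub-problem (D-0017)

namespace Summit.PneNP.PneNP.Theorems.MonotoneContinuation

open Literature.Computability.Complexity hiding supp mem_supp
open Finset hiding slice
open Classical
open Summit.PneNP.PneNP.Theorems (card_slice)
open Summit.PneNP.PneNP.Theorems.ConstantBand.Negative (Edge slice)
open Summit.PneNP.PneNP.Theorems.SliceACZero.Negative (supp mem_supp card_supp)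
open Summit.PneNP.PneNP.Theorems.SliceTargetSplit (nbhd mem_nbhd nbhdCard sum_slice_sum_nbhd_left
  supp_subset_of_comp_of_le comp_comm le_of_supp_subset)

noncomputable section

variable {n : ℕ}

/-! ### Monotonicity along comparable pairs -/

/-- A monotone Boolean function accepting `x` accepts everything above `x`. [folklore] -/
private theorem profileDrop_true_of_le {f : (Edge n → Bool) → Bool} (hf : Monotone f) {x y : Edge n → Bool}
    (hxy : x ≤ y) (hx : f x = true) : f y = true := by
  have h1 : f x ≤ f y := hf hxy
  rw [hx] at h1
  revert h1
  cases f y <;> decide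

/-- A slice-`j` vector comparable with a weight-`(j-1)` vector lies above it. [folklore] -/
private theorem profileDrop_up {j : ℕ} {x z : Edge n → Bool} (hz : edgeCount z = j - 1) (hx : x ∈ nbhd j z) :
    edgeCount x = j ∧ supp z ⊆ supp x := by
  rw [mem_nbhd] at hx
  exact ⟨hx.1, supp_subset_of_comp_of_le (comp_comm.1 hx.2) (by rw [hx.1, hz]; exact Nat.sub_le j 1)⟩

/-! ### The two charging arguments -/

/-- **Cofragile points.** The points of `Z` accepted by a monotone `f` number at most `φ` times the accepted
rejected-by-`h` points of slice `j`: each such `z` lies below a point outside `h`, which `f` accepts too, and every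
slice-`j` point lies above at most `φ` points of `Z`. [folklore] -/
theorem profileDrop_cardZ {j φ : ℕ} {h f : (Edge n → Bool) → Bool} (hf : Monotone f)
    {Z : Finset (Edge n → Bool)}
    (hZ : ∀ z ∈ Z, edgeCount z = j - 1 ∧ 1 ≤ #((nbhd j z).filter fun x => h x = false))
    (hφ : ∀ x ∈ slice n j, #(Z.filter fun z => ∀ e, z e = true → x e = true) ≤ φ) :
    #(Z.filter fun z => f z = true) ≤ φ * #((slice n j).filter fun x => h x = false ∧ f x = true) := by
  set E₀ := (slice n j).filter fun x => h x = false ∧ f x = true with hE₀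
  have hsub : (Z.filter fun z => f z = true) ⊆
      E₀.biUnion fun x => Z.filter fun z => ∀ e, z e = true → x e = true := by
    intro z hz
    rw [mem_filter] at hz
    obtain ⟨hzj, h1⟩ := hZ z hz.1
    obtain ⟨x, hx⟩ := card_pos.1 h1
    rw [mem_filter] at hx
    obtain ⟨hxj, hzx⟩ := profileDrop_up hzj hx.1
    rw [mem_biUnion]
    refine ⟨x, ?_, ?_⟩
    · rw [hE₀, mem_filter]
      refine ⟨?_, hx.2, profileDrop_true_of_le hf (le_of_supp_subset hzx) hz.2⟩
      simp only [slice, mem_filter, mem_univ, true_and]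
      exact hxj
    · rw [mem_filter]
      exact ⟨hz.1, fun e he => mem_supp.1 (hzx (mem_supp.2 he))⟩
  calc #(Z.filter fun z => f z = true)
      ≤ #(E₀.biUnion fun x => Z.filter fun z => ∀ e, z e = true → x e = true) := card_le_card hsub
    _ ≤ ∑ x ∈ E₀, #(Z.filter fun z => ∀ e, z e = true → x e = true) := card_biUnion_le
    _ ≤ ∑ _x ∈ E₀, φ := sum_le_sum fun x hx => hφ x (mem_filter.1 hx).1
    _ = φ * #E₀ := by rw [sum_const, smul_eq_mul, mul_comm]

/-- **Corobust points.** Double counting the pairs (accepted point of slice `j` outside `h`, comparable point of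
slice `j-1`): every point of `R` accepted by a monotone `f` contributes at least `C(n,2)-(j-1)-b` pairs, and every
slice-`j` point lies in exactly `j` pairs. [folklore] -/
theorem profileDrop_cardR {j b : ℕ} {h f : (Edge n → Bool) → Bool} (hf : Monotone f) (hj : 1 ≤ j)
    {R : Finset (Edge n → Bool)}
    (hR : ∀ z ∈ R, edgeCount z = j - 1 ∧ n.choose 2 - (j - 1) - b ≤ #((nbhd j z).filter fun x => h x = false))
    (hb : b ≤ n.choose 2 - (j - 1)) :
    (#(R.filter fun z => f z = true) : ℝ) * ((n.choose 2 - (j - 1) : ℕ) - b)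
      ≤ (j : ℝ) * #((slice n j).filter fun x => h x = false ∧ f x = true) := by
  have hN : nbhdCard (n.choose 2) j (j - 1) = j := by
    unfold nbhdCard
    rw [if_pos (Nat.sub_le j 1), Nat.choose_symm hj, Nat.choose_one_right]
  have hRs : (R.filter fun z => f z = true) ⊆ slice n (j - 1) := by
    intro z hz
    simp only [slice, mem_filter, mem_univ, true_and]
    exact (hR z (mem_filter.1 hz).1).1
  calc (#(R.filter fun z => f z = true) : ℝ) * ((n.choose 2 - (j - 1) : ℕ) - b)
      = ∑ _z ∈ R.filter (fun z => f z = true), ((n.choose 2 - (j - 1) - b : ℕ) : ℝ) := by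
        rw [sum_const, nsmul_eq_mul, Nat.cast_sub hb]
    _ ≤ ∑ z ∈ R.filter (fun z => f z = true),
          (#((nbhd j z).filter fun x => h x = false ∧ f x = true) : ℝ) := by
        refine sum_le_sum fun z hz => ?_
        rw [mem_filter] at hz
        obtain ⟨hzj, hcard⟩ := hR z hz.1
        have heq : ((nbhd j z).filter fun x => h x = false) =
            (nbhd j z).filter fun x => h x = false ∧ f x = true := by
          refine filter_congr fun x hx => ?_
          have hfx := profileDrop_true_of_le hf (le_of_supp_subset (profileDrop_up hzj hx).2) hz.2
          simp only [hfx, and_true]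
        rw [← heq]
        exact_mod_cast hcard
    _ ≤ ∑ z ∈ slice n (j - 1), (#((nbhd j z).filter fun x => h x = false ∧ f x = true) : ℝ) :=
        sum_le_sum_of_subset_of_nonneg hRs fun _ _ _ => Nat.cast_nonneg _
    _ = ∑ z ∈ slice n (j - 1), ∑ x ∈ nbhd j z, (if h x = false ∧ f x = true then (1 : ℝ) else 0) := by
        simp only [sum_boole]
    _ = (nbhdCard (n.choose 2) j (j - 1) : ℝ) *
          ∑ x ∈ slice n j, (if h x = false ∧ f x = true then (1 : ℝ) else 0) :=
        sum_slice_sum_nbhd_left _ _ _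
    _ = (j : ℝ) * #((slice n j).filter fun x => h x = false ∧ f x = true) := by
        rw [sum_boole, hN]

/-! ### Bookkeeping -/

/-- `j·#slice_j = (C(n,2) - (j-1))·#slice_{j-1}` for `1 ≤ j` (both count the comparable pairs between the two
slices). [folklore] -/
private theorem profileDrop_choose (n : ℕ) {j : ℕ} (hj : 1 ≤ j) :
    (j : ℝ) * #(slice n j) = ((n.choose 2 - (j - 1) : ℕ) : ℝ) * #(slice n (j - 1)) := by
  rw [card_slice, card_slice]
  have h' := Nat.choose_succ_right_eq (n.choose 2) (j - 1)
  rw [Nat.sub_add_cancel hj] at h'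
  have h'' : (((n.choose 2).choose j * j : ℕ) : ℝ) = ((n.choose 2).choose (j - 1) * (n.choose 2 - (j - 1)) : ℕ) := by
    rw [h']
  simp only [Nat.cast_mul] at h''
  linarith [h'']

/-- The final bookkeeping of `profileDrop_of_cofragile` (linear arithmetic over the reals). [folklore] -/
private theorem profileDrop_arith {Sj Si ZR Hc Fj Fi Dc E Z0 R0 M φ η jb j1 : ℝ}
    (hD : Dc ≤ η * Sj) (hE : E ≤ Dc) (hFj : Fj ≤ Hc + Dc) (hZR : ZR ≤ Fi + Z0 + R0)
    (hZ0 : Z0 ≤ φ * E) (hR0 : R0 * jb ≤ M * E) (hM : M * Sj = j1 * Si) (hjb : j1 ≤ 2 * jb) (hj1 : 0 < j1)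
    (hφ : 0 ≤ φ) (hM0 : 0 ≤ M) (hR00 : 0 ≤ R0) (hSj : 0 < Sj) (hSi : 0 ≤ Si) :
    ZR - Si / Sj * Hc - η * (3 * Si + φ * Sj) ≤ Fi - Si / Sj * Fj := by
  have hρ : 0 ≤ Si / Sj := div_nonneg hSi hSj.le
  have hρD : Si / Sj * Dc ≤ η * Si := by
    calc Si / Sj * Dc ≤ Si / Sj * (η * Sj) := mul_le_mul_of_nonneg_left hD hρ
      _ = η * Si := by field_simp
  have hρF : Si / Sj * Fj ≤ Si / Sj * Hc + η * Si := by
    calc Si / Sj * Fj ≤ Si / Sj * (Hc + Dc) := mul_le_mul_of_nonneg_left hFj hρ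
      _ = Si / Sj * Hc + Si / Sj * Dc := mul_add _ _ _
      _ ≤ _ := by linarith [hρD]
  have hZ0' : Z0 ≤ φ * (η * Sj) := hZ0.trans (mul_le_mul_of_nonneg_left (hE.trans hD) hφ)
  have hR0' : R0 ≤ 2 * η * Si := by
    have hME : M * E ≤ M * (η * Sj) := mul_le_mul_of_nonneg_left (hE.trans hD) hM0
    have h1 : j1 * R0 ≤ j1 * (2 * η * Si) := by
      calc j1 * R0 ≤ 2 * jb * R0 := mul_le_mul_of_nonneg_right hjb hR00
        _ = 2 * (R0 * jb) := by ring
        _ ≤ 2 * (M * (η * Sj)) := by linarith [hR0, hME]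
        _ = 2 * η * (M * Sj) := by ring
        _ = j1 * (2 * η * Si) := by rw [hM]; ring
    exact le_of_mul_le_mul_left h1 hj1
  linarith [hρF, hZ0', hR0', hZR]

/-! ### The obstruction lemma, downward -/

/-- **Profile drop forced by cofragility (width-1 obstruction, downward).** Let `h` be any Boolean function (read on
slice `j`, `1 ≤ j ≤ C(n,2)`), `Z` a set of weight-`(j-1)` points each having at least one up-neighbour outside `h`,
`b ≤ (C(n,2)-(j-1))/2`, and suppose every point of slice `j` has at most `φ` down-neighbours in `Z`. Then every
MONOTONE `f` with at most `η·#slice_j` disagreements with `h` on slice `j` satisfies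
`#{f = 0 on slice j-1} − (#slice_{j-1}/#slice_j)·#{f = 0 on slice j}
   ≥ #(Z ∪ R_b) − (#slice_{j-1}/#slice_j)·#{h = 0 on slice j} − η·(3·#slice_{j-1} + φ·#slice_j)`,
where `R_b` = weight-`(j-1)` points with at least `C(n,2)-(j-1)-b` up-neighbours outside `h`. [folklore] -/
theorem profileDrop_of_cofragile :
  ∀ (n j b φ : ℕ) (η : ℝ) (h f : (Edge n → Bool) → Bool), Monotone f → 1 ≤ j → j ≤ n.choose 2 →
    ∀ (Z R : Finset (Edge n → Bool)),
    (∀ z ∈ Z, edgeCount z = j - 1 ∧ 1 ≤ #((nbhd j z).filter fun x => h x = false)) →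
    (∀ z, z ∈ R ↔ edgeCount z = j - 1 ∧ n.choose 2 - (j - 1) - b ≤ #((nbhd j z).filter fun x => h x = false)) →
    2 * b ≤ n.choose 2 - (j - 1) →
    (∀ x ∈ slice n j, #(Z.filter fun z => ∀ e, z e = true → x e = true) ≤ φ) →
    (#((slice n j).filter fun x => f x ≠ h x) : ℝ) ≤ η * #(slice n j) →
    (#(Z ∪ R) : ℝ) - (#(slice n (j - 1)) : ℝ) / #(slice n j) * #((slice n j).filter fun x => h x = false)
        - η * (3 * #(slice n (j - 1)) + φ * #(slice n j))
      ≤ #((slice n (j - 1)).filter fun z => f z = false)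
        - (#(slice n (j - 1)) : ℝ) / #(slice n j) * #((slice n j).filter fun x => f x = false) := by
  intro n j b φ η h f hf hj hjN Z R hZ hR hb hφ hη
  have hRimp : ∀ z ∈ R, edgeCount z = j - 1 ∧
      n.choose 2 - (j - 1) - b ≤ #((nbhd j z).filter fun x => h x = false) :=
    fun z hz => (hR z).1 hz
  -- `E₀ ⊆ D`
  have hED : #((slice n j).filter fun x => h x = false ∧ f x = true)
      ≤ #((slice n j).filter fun x => f x ≠ h x) := by
    refine card_le_card fun x hx => ?_
    rw [mem_filter] at hx ⊢
    refine ⟨hx.1, ?_⟩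
    rw [hx.2.1, hx.2.2]
    decide
  -- `F_j ⊆ Hᶜ ∪ D`
  have hFj : #((slice n j).filter fun x => f x = false)
      ≤ #((slice n j).filter fun x => h x = false) + #((slice n j).filter fun x => f x ≠ h x) := by
    refine (card_le_card fun x hx => ?_).trans (card_union_le _ _)
    rw [mem_filter] at hx
    rw [mem_union, mem_filter, mem_filter]
    cases hhx : h x
    · left
      exact ⟨hx.1, rfl⟩
    · right
      refine ⟨hx.1, ?_⟩
      rw [hx.2]
      decide
  -- `Z ∪ R` splits into its rejected part (inside the rejected part of slice `j-1`) and the two accepted parts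
  have hZR : #(Z ∪ R) ≤ #((slice n (j - 1)).filter fun z => f z = false)
      + #(Z.filter fun z => f z = true) + #(R.filter fun z => f z = true) := by
    have hsl : Z ∪ R ⊆ slice n (j - 1) := by
      intro z hz
      rw [mem_union] at hz
      simp only [slice, mem_filter, mem_univ, true_and]
      exact hz.elim (fun h' => (hZ z h').1) (fun h' => (hRimp z h').1)
    have h1 : #((Z ∪ R).filter fun z => f z = false) ≤ #((slice n (j - 1)).filter fun z => f z = false) :=
      card_le_card (filter_subset_filter _ hsl)
    have h2 : #((Z ∪ R).filter fun z => ¬ f z = false)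
        ≤ #(Z.filter fun z => f z = true) + #(R.filter fun z => f z = true) := by
      rw [filter_union]
      refine (card_union_le _ _).trans (add_le_add (card_le_card ?_) (card_le_card ?_)) <;>
      · intro z
        simp only [mem_filter, Bool.not_eq_false]
        exact id
    have h3 := card_filter_add_card_filter_not (s := Z ∪ R) (fun z => f z = false)
    omega
  -- cast to the reals and assemble
  have hED' : (#((slice n j).filter fun x => h x = false ∧ f x = true) : ℝ)
      ≤ #((slice n j).filter fun x => f x ≠ h x) := by exact_mod_cast hED
  have hFj' : (#((slice n j).filter fun x => f x = false) : ℝ)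
      ≤ #((slice n j).filter fun x => h x = false) + #((slice n j).filter fun x => f x ≠ h x) := by
    exact_mod_cast hFj
  have hZR' : (#(Z ∪ R) : ℝ) ≤ #((slice n (j - 1)).filter fun z => f z = false)
      + #(Z.filter fun z => f z = true) + #(R.filter fun z => f z = true) := by exact_mod_cast hZR
  have hZ0 : (#(Z.filter fun z => f z = true) : ℝ)
      ≤ (φ : ℝ) * #((slice n j).filter fun x => h x = false ∧ f x = true) := by
    exact_mod_cast profileDrop_cardZ hf hZ hφ
  have hb' : (2 : ℝ) * b ≤ ((n.choose 2 - (j - 1) : ℕ) : ℝ) := by exact_mod_cast hb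
  have hj1 : (0 : ℝ) < ((n.choose 2 - (j - 1) : ℕ) : ℝ) := by
    exact_mod_cast (show 0 < n.choose 2 - (j - 1) by omega)
  have hSj : (0 : ℝ) < #(slice n j) := by
    rw [card_slice]
    exact_mod_cast Nat.choose_pos hjN
  exact profileDrop_arith hη hED' hFj' hZR' hZ0 (profileDrop_cardR hf hj hRimp (by omega))
    (profileDrop_choose n hj) (by linarith) hj1 (Nat.cast_nonneg _) (Nat.cast_nonneg _) (Nat.cast_nonneg _)
    hSj (Nat.cast_nonneg _)

end

end Summit.PneNP.PneNP.Theorems.MonotoneContinuation
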